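import Mathlib.Analysis.SpecialFunctions.Gaussian.GaussianIntegral
import Mathlib.MeasureTheory.Measure.Lebesgue.Integral
import Mathlib.MeasureTheory.Group.Integral
import Literature.Analysis.Matrix.SchoenbergKernelsProofs
import HarnessLib

/-!
# Gaussian subordination: a positive-type splitting of `exp (β χ²)` across a sign flip of `χ`

Let `H` be a group and `χ : H → ℝ` a continuous, symmetric (`χ h⁻¹ = χ h`), central
(`χ (g h g⁻¹) = χ h`) function of positive type (`Σ cᵢ cⱼ χ(xᵢ⁻¹ xⱼ) ≥ 0`) — e.g. the real part
of the character of a finite-dimensional unitary representation of a compact group. For `β > 0`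
the moment generating function of the centred Gaussian,

  `exp (β c²) = (4πβ)^{-1/2} ∫_ℝ e^{-s²/(4β)} e^{s c} ds`,

writes the class function `exp (β χ²)` as a Gaussian mixture of the functions `e^{s χ}`, each of
which is of positive type by Schur's product theorem (Berg–Christensen–Ressel Ch. 3 Cor. 1.14:
`exp` of a positive definite kernel is positive definite). Keeping only the half line `s > 0`,

  `w h := (4πβ)^{-1/2} ∫_0^∞ e^{-s²/(4β)} e^{s χ(h)} ds`

is again continuous, non-negative, symmetric, central and of positive type, and the reflection
`s ↦ -s` shows `w h + w h' = exp (β χ(h)²)` whenever `χ h' = -χ h` — in particular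
`w h + w (k h) = exp (β χ(h)²)` for a central involution `k` with `χ (k h) = -χ h` (the
non-trivial deck transformation of `SU(2) → SO(3)` acting on the fundamental character).
Moreover on `{χ ≥ 0}` the defect `exp (β χ²) − w = (4πβ)^{-1/2} ∫_{-∞}^0 e^{-s²/(4β)} e^{s χ} ds`
is at most `1/2`. This "Gaussian subordination" is the mechanism behind a positive-type,
centre-sensitive splitting of a centre-blind Wilson weight `exp (β ((Re tr h)² − 1))`; no
Peter–Weyl theory is used.

Main result: `exists_posType_gaussian_splitting`. Auxiliary: the passage between the real
(`Literature.Analysis.Matrix.IsPosDefKernel`-style) and the complex (`Re Σ conj vᵢ vⱼ f(xᵢ⁻¹ xⱼ)`)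
forms of "positive type" for real-valued functions on a group, and the one-dimensional
Gaussian integrals used (moment generating function, half-line masses, reflection).
Everything is proved; no definition is introduced. [folklore]
-/

set_option autoImplicit false

noncomputable section

open MeasureTheory Set Filter Real
open scoped Topology BigOperators

namespace Literature.RepresentationTheory.CompactGroups

open _root_.Literature.Analysis.Matrix

/-! ### Real versus complex positive type -/

section PosType

variable {H : Type*} [Group H]

/-- Real part of a Hermitian double sum against a REAL kernel: writing `v = a + i b`,
`Re Σ conj(vᵢ) vⱼ Kᵢⱼ = Σ aᵢ aⱼ Kᵢⱼ + Σ bᵢ bⱼ Kᵢⱼ`. [folklore] -/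
theorem re_sum_conj_mul_mul_ofReal {n : ℕ} (K : Fin n → Fin n → ℝ) (v : Fin n → ℂ) :
    (∑ i, ∑ j, (starRingEnd ℂ) (v i) * v j * (K i j : ℂ)).re =
      (∑ i, ∑ j, (v i).re * (v j).re * K i j) + ∑ i, ∑ j, (v i).im * (v j).im * K i j := by
  simp only [Complex.re_sum, Complex.mul_re, Complex.mul_im, Complex.conj_re, Complex.conj_im,
    Complex.ofReal_re, Complex.ofReal_im, mul_zero, sub_zero, ← Finset.sum_add_distrib]
  refine Finset.sum_congr rfl fun i _ => Finset.sum_congr rfl fun j _ => ?_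
  ring

/-- A real-valued function `f` on a group which is of positive type on REAL test vectors,
`0 ≤ Σ cᵢ cⱼ f(xᵢ⁻¹ xⱼ)`, is of positive type on COMPLEX test vectors,
`0 ≤ Re Σ conj(vᵢ) vⱼ f(xᵢ⁻¹ xⱼ)` (split `v` into real and imaginary parts). [folklore] -/
theorem re_sum_conj_mul_nonneg_of_real {f : H → ℝ}
    (hf : ∀ (n : ℕ) (x : Fin n → H) (c : Fin n → ℝ),
      0 ≤ ∑ i, ∑ j, c i * c j * f ((x i)⁻¹ * x j))
    (n : ℕ) (x : Fin n → H) (v : Fin n → ℂ) :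
    0 ≤ (∑ i, ∑ j, (starRingEnd ℂ) (v i) * v j * ((f ((x i)⁻¹ * x j) : ℝ) : ℂ)).re := by
  rw [re_sum_conj_mul_mul_ofReal (fun i j => f ((x i)⁻¹ * x j)) v]
  exact add_nonneg (hf n x fun i => (v i).re) (hf n x fun i => (v i).im)

/-- Conversely, a real-valued function of positive type on complex test vectors is of positive
type on real test vectors. [folklore] -/
theorem sum_mul_mul_nonneg_of_complex {f : H → ℝ}
    (hf : ∀ (n : ℕ) (x : Fin n → H) (v : Fin n → ℂ),
      0 ≤ (∑ i, ∑ j, (starRingEnd ℂ) (v i) * v j * ((f ((x i)⁻¹ * x j) : ℝ) : ℂ)).re)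
    (n : ℕ) (x : Fin n → H) (c : Fin n → ℝ) :
    0 ≤ ∑ i, ∑ j, c i * c j * f ((x i)⁻¹ * x j) := by
  have h := hf n x fun i => (c i : ℂ)
  rw [re_sum_conj_mul_mul_ofReal (fun i j => f ((x i)⁻¹ * x j))] at h
  simpa only [Complex.ofReal_re, Complex.ofReal_im, zero_mul, Finset.sum_const_zero,
    add_zero] using h

end PosType

/-! ### One-dimensional Gaussian integrals -/

section Gaussian

/-- Completing the square: `e^{-b s²} e^{s c} = e^{-b (s - c/(2b))²} e^{c²/(4b)}` (`b ≠ 0`).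
[folklore] -/
theorem exp_neg_mul_sq_mul_exp_mul {b : ℝ} (hb : b ≠ 0) (s c : ℝ) :
    exp (-b * s ^ 2) * exp (s * c) = exp (-b * (s - c / (2 * b)) ^ 2) * exp (c ^ 2 / (4 * b)) := by
  rw [← exp_add, ← exp_add]
  congr 1
  field_simp
  ring

/-- The Gaussian-times-exponential `s ↦ e^{-b s²} e^{s c}` is integrable on `ℝ` (`b > 0`).
[folklore] -/
theorem integrable_gaussMGF {b : ℝ} (hb : 0 < b) (c : ℝ) :
    Integrable fun s : ℝ => exp (-b * s ^ 2) * exp (s * c) := by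
  simp_rw [exp_neg_mul_sq_mul_exp_mul hb.ne']
  exact ((integrable_exp_neg_mul_sq hb).comp_sub_right (c / (2 * b))).mul_const _

/-- **Moment generating function of the centred Gaussian**:
`∫_ℝ e^{-b s²} e^{s c} ds = √(π/b) e^{c²/(4b)}` (`b > 0`). [folklore] -/
theorem integral_gaussMGF {b : ℝ} (hb : 0 < b) (c : ℝ) :
    ∫ s : ℝ, exp (-b * s ^ 2) * exp (s * c) = √(π / b) * exp (c ^ 2 / (4 * b)) := by
  simp_rw [exp_neg_mul_sq_mul_exp_mul hb.ne']
  rw [integral_mul_const]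
  congr 1
  rw [← integral_gaussian b]
  exact integral_sub_right_eq_self (μ := (volume : Measure ℝ)) (fun s => exp (-b * s ^ 2)) _

/-- Reflection `s ↦ -s`: `∫_{s > 0} e^{-b s²} e^{-s c} ds = ∫_{s ≤ 0} e^{-b s²} e^{s c} ds`.
[folklore] -/
theorem integral_Ioi_gaussMGF_neg (b c : ℝ) :
    ∫ s in Ioi (0 : ℝ), exp (-b * s ^ 2) * exp (s * -c) =
      ∫ s in Iic (0 : ℝ), exp (-b * s ^ 2) * exp (s * c) := by
  have h := integral_comp_neg_Ioi 0 (fun t : ℝ => exp (-b * t ^ 2) * exp (t * c))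
  simp only [neg_zero, neg_sq, neg_mul, mul_neg] at h ⊢
  exact h

/-- Half the Gaussian mass sits on the non-positive half line:
`∫_{s ≤ 0} e^{-b s²} ds = √(π/b)/2` (`b > 0`). [folklore] -/
theorem integral_Iic_exp_neg_mul_sq {b : ℝ} (hb : 0 < b) :
    ∫ s in Iic (0 : ℝ), exp (-b * s ^ 2) = √(π / b) / 2 := by
  have h := integral_add_compl (μ := (volume : Measure ℝ))
    (measurableSet_Ioi : MeasurableSet (Ioi (0 : ℝ))) (integrable_exp_neg_mul_sq hb)
  rw [compl_Ioi, integral_gaussian, integral_gaussian_Ioi] at h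
  linarith

/-- Splitting the moment generating function at `s = 0`:
`∫_{s>0} e^{-b s²} e^{s c} + ∫_{s ≤ 0} e^{-b s²} e^{s c} = √(π/b) e^{c²/(4b)}`. [folklore] -/
theorem integral_Ioi_add_Iic_gaussMGF {b : ℝ} (hb : 0 < b) (c : ℝ) :
    (∫ s in Ioi (0 : ℝ), exp (-b * s ^ 2) * exp (s * c)) +
        ∫ s in Iic (0 : ℝ), exp (-b * s ^ 2) * exp (s * c) = √(π / b) * exp (c ^ 2 / (4 * b)) := by
  rw [← integral_gaussMGF hb c, ← compl_Ioi,
    integral_add_compl measurableSet_Ioi (integrable_gaussMGF hb c)]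

/-- For `c ≥ 0` the non-positive half line carries at most half the Gaussian mass:
`∫_{s ≤ 0} e^{-b s²} e^{s c} ds ≤ √(π/b)/2`. [folklore] -/
theorem integral_Iic_gaussMGF_le {b : ℝ} (hb : 0 < b) {c : ℝ} (hc : 0 ≤ c) :
    ∫ s in Iic (0 : ℝ), exp (-b * s ^ 2) * exp (s * c) ≤ √(π / b) / 2 := by
  rw [← integral_Iic_exp_neg_mul_sq hb]
  refine setIntegral_mono_on (integrable_gaussMGF hb c).integrableOn
    (integrable_exp_neg_mul_sq hb).integrableOn measurableSet_Iic fun s hs => ?_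
  have h1 : exp (s * c) ≤ 1 := exp_le_one_iff.2 (mul_nonpos_of_nonpos_of_nonneg hs hc)
  calc exp (-b * s ^ 2) * exp (s * c) ≤ exp (-b * s ^ 2) * 1 :=
        mul_le_mul_of_nonneg_left h1 (exp_pos _).le
    _ = exp (-b * s ^ 2) := mul_one _

/-- The half-line moment generating function is non-negative. [folklore] -/
theorem integral_Ioi_gaussMGF_nonneg (b c : ℝ) :
    0 ≤ ∫ s in Ioi (0 : ℝ), exp (-b * s ^ 2) * exp (s * c) :=
  setIntegral_nonneg measurableSet_Ioi fun s _ => by positivity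

/-- The half-line moment generating function `c ↦ ∫_{s>0} e^{-b s²} e^{s c} ds` is continuous
(dominated convergence, dominating `e^{-b s²} e^{s (|c₀| + 1)}` near `c₀`). [folklore] -/
theorem continuous_integral_Ioi_gaussMGF {b : ℝ} (hb : 0 < b) :
    Continuous fun c : ℝ => ∫ s in Ioi (0 : ℝ), exp (-b * s ^ 2) * exp (s * c) := by
  refine continuous_iff_continuousAt.2 fun c₀ => ?_
  have hball : ∀ᶠ c in 𝓝 c₀, c ≤ |c₀| + 1 := by
    filter_upwards [Metric.ball_mem_nhds c₀ one_pos] with c hc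
    have h1 := abs_lt.1 (Real.dist_eq c c₀ ▸ Metric.mem_ball.1 hc)
    have h2 := le_abs_self c₀
    linarith [h1.2]
  refine continuousAt_of_dominated
    (bound := fun s => exp (-b * s ^ 2) * exp (s * (|c₀| + 1))) ?_ ?_ ?_ ?_
  · exact Eventually.of_forall fun c =>
      (by fun_prop : Continuous fun s : ℝ => exp (-b * s ^ 2) * exp (s * c)).aestronglyMeasurable
  · filter_upwards [hball] with c hc
    filter_upwards [ae_restrict_mem measurableSet_Ioi] with s hs
    rw [Real.norm_of_nonneg (by positivity)]
    exact mul_le_mul_of_nonneg_left (exp_le_exp.2 (mul_le_mul_of_nonneg_left hc (le_of_lt hs)))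
      (exp_pos _).le
  · exact (integrable_gaussMGF hb _).integrableOn
  · exact Eventually.of_forall fun s =>
      (by fun_prop : Continuous fun c : ℝ => exp (-b * s ^ 2) * exp (s * c)).continuousAt

end Gaussian

/-! ### Positive type of the half-line Gaussian mixture -/

section Mixture

variable {H : Type*} [Group H]

/-- **Schur–Schoenberg step.** If `χ` is symmetric and of (real) positive type on the group `H`,
then so is the half-line Gaussian mixture `h ↦ ∫_{s>0} e^{-b s²} e^{s χ(h)} ds`: for each `s ≥ 0`
the kernel `e^{s χ(x⁻¹ y)}` is positive definite (BCR Ch. 3 Cor. 1.14, `IsPosDefKernel.exp`),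
and the quadratic form of the mixture is the `s`-integral of non-negative quadratic forms.
[folklore] -/
theorem sum_mul_mul_integral_Ioi_gaussMGF_nonneg (χ : H → ℝ) (hχi : ∀ h, χ h⁻¹ = χ h)
    (hχp : ∀ (n : ℕ) (x : Fin n → H) (c : Fin n → ℝ),
      0 ≤ ∑ i, ∑ j, c i * c j * χ ((x i)⁻¹ * x j))
    {b : ℝ} (hb : 0 < b) (n : ℕ) (x : Fin n → H) (c : Fin n → ℝ) :
    0 ≤ ∑ i, ∑ j, c i * c j *
      ∫ s in Ioi (0 : ℝ), exp (-b * s ^ 2) * exp (s * χ ((x i)⁻¹ * x j)) := by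
  have hK : IsPosDefKernel fun g h : H => χ (g⁻¹ * h) :=
    ⟨fun g h => by
      show χ (g⁻¹ * h) = χ (h⁻¹ * g)
      rw [← hχi (g⁻¹ * h), mul_inv_rev, inv_inv], hχp⟩
  have hpt : ∀ s : ℝ, 0 ≤ s →
      0 ≤ ∑ i, ∑ j, c i * c j * (exp (-b * s ^ 2) * exp (s * χ ((x i)⁻¹ * x j))) :=
    fun s hs => (((hK.const_mul hs).exp).const_mul (exp_pos (-b * s ^ 2)).le).2 n x c
  have hint : ∀ i j : Fin n, Integrable
      (fun s : ℝ => exp (-b * s ^ 2) * exp (s * χ ((x i)⁻¹ * x j)))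
      ((volume : Measure ℝ).restrict (Ioi 0)) :=
    fun i j => (integrable_gaussMGF hb _).integrableOn
  have key : (∫ s in Ioi (0 : ℝ),
      ∑ i, ∑ j, c i * c j * (exp (-b * s ^ 2) * exp (s * χ ((x i)⁻¹ * x j)))) =
      ∑ i, ∑ j, c i * c j *
        ∫ s in Ioi (0 : ℝ), exp (-b * s ^ 2) * exp (s * χ ((x i)⁻¹ * x j)) := by
    rw [integral_finsetSum _ fun i _ =>
      integrable_finsetSum _ fun j _ => (hint i j).const_mul (c i * c j)]
    refine Finset.sum_congr rfl fun i _ => ?_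
    rw [integral_finsetSum _ fun j _ => (hint i j).const_mul (c i * c j)]
    refine Finset.sum_congr rfl fun j _ => ?_
    exact integral_const_mul _ _
  rw [← key]
  exact setIntegral_nonneg measurableSet_Ioi fun s hs => hpt s (le_of_lt hs)

end Mixture

/-! ### The splitting -/

section Main

variable {H : Type*} [Group H] [TopologicalSpace H]

/-- **Gaussian subordination: a positive-type splitting of `exp (β χ²)` across a sign flip of
`χ`.** Let `χ : H → ℝ` be continuous, symmetric, central and of (real) positive type on the
topological group `H`, and `β > 0`. Then there is `w : H → ℝ` — namely
`w h = (4πβ)^{-1/2} ∫_0^∞ e^{-s²/(4β)} e^{s χ(h)} ds` — which is continuous, non-negative,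
symmetric, central, of positive type on real AND on complex test vectors
(`0 ≤ Re Σ conj(vᵢ) vⱼ w(xᵢ⁻¹ xⱼ)`), and satisfies
* EXACTNESS: `w h + w h' = exp (β χ(h)²)` whenever `χ h' = -χ h` (so `w h + w (k h) = exp (β χ(h)²)`
  for a central involution `k` flipping `χ`);
* `w ≤ exp (β χ²)` everywhere, and NOISE `exp (β χ(h)²) - w h ≤ 1/2` wherever `χ h ≥ 0`.
Mechanism: moment generating function of the Gaussian + Schur product theorem
(BCR Ch. 3 Cor. 1.14). [folklore] -/
theorem exists_posType_gaussian_splitting (χ : H → ℝ) (hχc : Continuous χ)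
    (hχi : ∀ h, χ h⁻¹ = χ h) (hχcl : ∀ g h, χ (g * h * g⁻¹) = χ h)
    (hχp : ∀ (n : ℕ) (x : Fin n → H) (c : Fin n → ℝ),
      0 ≤ ∑ i, ∑ j, c i * c j * χ ((x i)⁻¹ * x j))
    {β : ℝ} (hβ : 0 < β) :
    ∃ w : H → ℝ, Continuous w ∧ (∀ h, 0 ≤ w h) ∧ (∀ h, w h⁻¹ = w h) ∧
      (∀ g h, w (g * h * g⁻¹) = w h) ∧
      (∀ (n : ℕ) (x : Fin n → H) (c : Fin n → ℝ),
        0 ≤ ∑ i, ∑ j, c i * c j * w ((x i)⁻¹ * x j)) ∧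
      (∀ (n : ℕ) (x : Fin n → H) (v : Fin n → ℂ),
        0 ≤ (∑ i, ∑ j, (starRingEnd ℂ) (v i) * v j * ((w ((x i)⁻¹ * x j) : ℝ) : ℂ)).re) ∧
      (∀ h h', χ h' = -χ h → w h + w h' = exp (β * χ h ^ 2)) ∧
      (∀ h, w h ≤ exp (β * χ h ^ 2)) ∧
      (∀ h, 0 ≤ χ h → exp (β * χ h ^ 2) - w h ≤ 1 / 2) := by
  have hb : (0 : ℝ) < 1 / (4 * β) := by positivity
  set b : ℝ := 1 / (4 * β) with hb_def
  have hZ : 0 < √(π / b) := sqrt_pos.2 (div_pos pi_pos hb)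
  have hZ' : 0 ≤ (√(π / b))⁻¹ := inv_nonneg.2 hZ.le
  have hcb : ∀ c : ℝ, c ^ 2 / (4 * b) = β * c ^ 2 := fun c => by
    rw [hb_def]
    field_simp
  have htot : ∀ c : ℝ, (√(π / b))⁻¹ * (∫ s in Ioi (0 : ℝ), exp (-b * s ^ 2) * exp (s * c)) +
      (√(π / b))⁻¹ * (∫ s in Iic (0 : ℝ), exp (-b * s ^ 2) * exp (s * c)) = exp (β * c ^ 2) :=
    fun c => by
    rw [← mul_add, integral_Ioi_add_Iic_gaussMGF hb, ← mul_assoc, inv_mul_cancel₀ hZ.ne', one_mul,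
      hcb]
  have hIic0 : ∀ c : ℝ, 0 ≤ (√(π / b))⁻¹ * ∫ s in Iic (0 : ℝ), exp (-b * s ^ 2) * exp (s * c) :=
    fun c => mul_nonneg hZ' (setIntegral_nonneg measurableSet_Iic fun s _ => by positivity)
  have hIic : ∀ c : ℝ, 0 ≤ c →
      (√(π / b))⁻¹ * ∫ s in Iic (0 : ℝ), exp (-b * s ^ 2) * exp (s * c) ≤ 1 / 2 := fun c hc =>
    calc (√(π / b))⁻¹ * ∫ s in Iic (0 : ℝ), exp (-b * s ^ 2) * exp (s * c)
        ≤ (√(π / b))⁻¹ * (√(π / b) / 2) :=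
          mul_le_mul_of_nonneg_left (integral_Iic_gaussMGF_le hb hc) hZ'
      _ = 1 / 2 := by field_simp
  have hreal : ∀ (n : ℕ) (x : Fin n → H) (c : Fin n → ℝ), 0 ≤ ∑ i, ∑ j, c i * c j *
      ((√(π / b))⁻¹ * ∫ s in Ioi (0 : ℝ), exp (-b * s ^ 2) * exp (s * χ ((x i)⁻¹ * x j))) := by
    intro n x c
    have h0 := sum_mul_mul_integral_Ioi_gaussMGF_nonneg χ hχi hχp hb n x c
    have e : ∑ i, ∑ j, c i * c j *
        ((√(π / b))⁻¹ * ∫ s in Ioi (0 : ℝ), exp (-b * s ^ 2) * exp (s * χ ((x i)⁻¹ * x j))) =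
        (√(π / b))⁻¹ * ∑ i, ∑ j, c i * c j *
          ∫ s in Ioi (0 : ℝ), exp (-b * s ^ 2) * exp (s * χ ((x i)⁻¹ * x j)) := by
      rw [Finset.mul_sum]
      refine Finset.sum_congr rfl fun i _ => ?_
      rw [Finset.mul_sum]
      exact Finset.sum_congr rfl fun j _ => by ring
    rw [e]
    exact mul_nonneg hZ' h0
  refine ⟨fun h => (√(π / b))⁻¹ * ∫ s in Ioi (0 : ℝ), exp (-b * s ^ 2) * exp (s * χ h),
    continuous_const.mul ((continuous_integral_Ioi_gaussMGF hb).comp hχc),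
    fun h => mul_nonneg hZ' (integral_Ioi_gaussMGF_nonneg b _),
    fun h => by simp only [hχi], fun g h => by simp only [hχcl], hreal,
    re_sum_conj_mul_nonneg_of_real
      (f := fun h => (√(π / b))⁻¹ * ∫ s in Ioi (0 : ℝ), exp (-b * s ^ 2) * exp (s * χ h)) hreal,
    fun h h' hh' => ?_, fun h => ?_, fun h hh => ?_⟩
  · show (√(π / b))⁻¹ * (∫ s in Ioi (0 : ℝ), exp (-b * s ^ 2) * exp (s * χ h)) +
      (√(π / b))⁻¹ * (∫ s in Ioi (0 : ℝ), exp (-b * s ^ 2) * exp (s * χ h')) = exp (β * χ h ^ 2)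
    rw [hh', integral_Ioi_gaussMGF_neg]
    exact htot (χ h)
  · have h1 := htot (χ h)
    have h2 := hIic0 (χ h)
    show (√(π / b))⁻¹ * (∫ s in Ioi (0 : ℝ), exp (-b * s ^ 2) * exp (s * χ h)) ≤ exp (β * χ h ^ 2)
    linarith
  · have h1 := htot (χ h)
    have h2 := hIic (χ h) hh
    show exp (β * χ h ^ 2) -
      (√(π / b))⁻¹ * (∫ s in Ioi (0 : ℝ), exp (-b * s ^ 2) * exp (s * χ h)) ≤ 1 / 2
    linarith

end Main

end Literature.RepresentationTheory.CompactGroups
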